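import Mathlib

/-!
# A2Avoidance — a vector space over an infinite field is not a finite union of proper subspaces

Kernel-checked form of Lemma A4.2.6 of route/T4-A2-p6.md (sub-claim A2 of route/TIER4.md,
cell pub-hodge-repro2): for an infinite field `K`, a `K`-vector space `V` and finitely many
proper subspaces `U₁, …, Uₘ ⊊ V`, there is a vector outside all of them.  It is used in
(A4.2.7) to choose the `F`-compatible divisor class `θ_i ∈ D_i` with all three components
`c_{i,ν}` non-zero: the three coordinate functionals have proper kernels in the 3-dimensional
`ℚ`-space `D_i`.

The proof is the one written in the section: given `u` outside `U₁, …, U_{m-1}` and `w ∉ Uₘ`,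
at most one scalar `t` puts `u + t • w` into any fixed one of the `m` subspaces, so some `t`
(the field being infinite) avoids all of them.
-/

namespace Summit.Ventures.HodgeRepro2.A2Avoidance

variable {K : Type*} [Field K] {V : Type*} [AddCommGroup V] [Module K V]

/-- Two distinct scalars `t ≠ t'` with `u + t • w ∈ U` and `u + t' • w ∈ U` force `w ∈ U`. -/
theorem mem_of_add_smul_mem_of_ne (U : Submodule K V) (u w : V) {t t' : K} (h : t ≠ t')
    (h1 : u + t • w ∈ U) (h2 : u + t' • w ∈ U) : w ∈ U := by
  have hsub : (t - t') • w ∈ U := by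
    have := U.sub_mem h1 h2
    simpa [sub_smul, add_sub_add_left_eq_sub] using this
  have hne : t - t' ≠ 0 := sub_ne_zero.mpr h
  simpa [smul_smul, inv_mul_cancel₀ hne] using U.smul_mem (t - t')⁻¹ hsub

/-- If `u ∉ U` or `w ∉ U`, the set of scalars `t` with `u + t • w ∈ U` has at most one element. -/
theorem subsingleton_setOf_add_smul_mem (U : Submodule K V) (u w : V) (h : u ∉ U ∨ w ∉ U) :
    {t : K | u + t • w ∈ U}.Subsingleton := by
  intro t ht t' ht'
  by_contra hne
  have hw : w ∈ U := mem_of_add_smul_mem_of_ne U u w hne ht ht'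
  rcases h with hu | hw'
  · apply hu
    have := U.sub_mem ht (U.smul_mem t hw)
    simpa using this
  · exact hw' hw

/-- **Avoidance lemma** (Lemma A4.2.6).  Over an infinite field, a vector space is not the
union of finitely many proper subspaces: for every finite set `s` of proper subspaces there
is a vector lying in none of them. -/
theorem exists_notMem_of_forall_ne_top [Infinite K] (s : Finset (Submodule K V))
    (hs : ∀ U ∈ s, U ≠ ⊤) : ∃ v : V, ∀ U ∈ s, v ∉ U := by
  classical
  induction s using Finset.induction_on with
  | empty => exact ⟨0, by simp⟩
  | insert U s hU ih =>
    obtain ⟨u, hu⟩ := ih (fun U' hU' => hs U' (Finset.mem_insert_of_mem hU'))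
    have hUtop : U ≠ ⊤ := hs U (Finset.mem_insert_self U s)
    obtain ⟨w, hw⟩ : ∃ w : V, w ∉ U := by
      by_contra hcontra
      exact hUtop (Submodule.eq_top_iff'.mpr (fun x => by_contra (fun hx => hcontra ⟨x, hx⟩)))
    -- the finitely many "bad" scalars
    have hbad : (⋃ U' ∈ (insert U s : Finset (Submodule K V)),
        {t : K | u + t • w ∈ U'}).Finite := by
      refine Set.Finite.biUnion (Finset.finite_toSet _) ?_
      intro U' hU'
      apply Set.Subsingleton.finite
      apply subsingleton_setOf_add_smul_mem
      rcases Finset.mem_insert.mp hU' with rfl | hU'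
      · exact Or.inr hw
      · exact Or.inl (hu U' hU')
    obtain ⟨t, ht⟩ := hbad.infinite_compl.nonempty
    refine ⟨u + t • w, ?_⟩
    intro U' hU' hmem
    apply ht
    exact Set.mem_biUnion (Finset.mem_coe.mpr hU') hmem

/-- The form used in (A4.2.7): three proper subspaces (the kernels of the three coordinate
functionals of `D_i ⊗ ℂ` restricted to `D_i`) are avoided by some vector. -/
theorem exists_notMem_three [Infinite K] (U₁ U₂ U₃ : Submodule K V)
    (h₁ : U₁ ≠ ⊤) (h₂ : U₂ ≠ ⊤) (h₃ : U₃ ≠ ⊤) :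
    ∃ v : V, v ∉ U₁ ∧ v ∉ U₂ ∧ v ∉ U₃ := by
  classical
  obtain ⟨v, hv⟩ := exists_notMem_of_forall_ne_top ({U₁, U₂, U₃} : Finset (Submodule K V))
    (by
      intro U hU
      simp only [Finset.mem_insert, Finset.mem_singleton] at hU
      rcases hU with rfl | rfl | rfl <;> assumption)
  exact ⟨v, hv U₁ (by simp), hv U₂ (by simp), hv U₃ (by simp)⟩

/-- The kernel of a non-zero linear functional is a proper subspace (used with the coordinate
functionals `λ_{i,ν}|_{D_i} : D_i → ℂ`, `ℂ` viewed as a `ℚ`-module). -/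
theorem ker_ne_top_of_ne_zero {W : Type*} [AddCommGroup W] [Module K W]
    (φ : V →ₗ[K] W) (hφ : φ ≠ 0) : LinearMap.ker φ ≠ ⊤ := by
  intro h
  apply hφ
  ext v
  have : v ∈ LinearMap.ker φ := by rw [h]; exact Submodule.mem_top
  simpa using this

end Summit.Ventures.HodgeRepro2.A2Avoidance
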